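import Summits.AtomisticToContinuum.BoseEinsteinCondensation.Theorems.BECThomsonPrincipleDensityResponseDefs
import Summits.AtomisticToContinuum.BoseEinsteinCondensation.Theorems.DensityResponse.Negative.PeriodisedWell
import Summits.AtomisticToContinuum.BoseEinsteinCondensation.Theorems.DensityResponse.Negative.ModulatedProductState
import Literature.MathematicalPhysics.QuantumManyBody.DiluteBoseGasUpperBoundLocalization

/-!
# Negative lemmas for crux `DensityResponse` (stmt-AtomisticToContinuum-9481) — hypothesis-mutation
# table for the stubs of line `force-balance-constitutive`

Supports (does not close) stmt-AtomisticToContinuum-9481.  Refuter (drefute) by-products for the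
picked line `Cruxes/DensityResponse/Lines/force-balance-constitutive.lean` (skeleton 5b7e7914fe83),
stated against the lead's importable `Defs` module `Theorems/BECThomsonPrincipleDensityResponseDefs`
(vocabulary `ksq`, `phase`, `kDeriv`, `sourceMean`, `effNumber`, `kineticStressWave`, `virialWave`,
`stressWave`; predicates `CoreIneq`, `KinIneq`; stub statements `TransportStationary` (S1),
`ConstitutiveCore` (S2)).  Everything is sorry-free.  (S3a/S3b are meanwhile PROVED by the line,
`Theorems/BECThomsonPrincipleDensityResponseKineticSignCoherence.lean`, along the reduction recorded
in the drefute report: `a > 0` by stationarity + window alone, `a = 0` by `v = 0` a.e.; that module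
is deliberately not imported here.)

* §A `kin_add_virial_eq_of_stationary` — the stationarity identity solved for the stress–virial
  wave, `K + I = s·N_eff − (|k|²/4)·m` (used throughout).
* §B `coreIneq_iff_noSign`, `constitutiveCore_iff_noSign` — in S2 the binder `0 ≤ m(Φ)` is NOT
  load-bearing (decoration): on a transport-stationary state with `m < 0` the conclusion holds
  outright, `κρa·m ≤ 0 ≤ s·N_eff + (|k|²/4)|m| + C₁sN = K + I + C₁sN`.
  `coreIneq_iff_lr`, `coreIneq_of_lr_bound` — on transport-stationary states the constitutive
  inequality IS the linear-response bound `(κρa + |k|²/4)·m ≤ s·N_eff + C₁·s·N` (a rearrangement of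
  the stationarity identity): S2 is the crux's `s → 0` content verbatim (its chord at drive `2s`),
  with `E₀(v_t)` entering only through the class constraint.
* §C `not_transportStationaryAnyMode` — **`n ≠ 0` is load-bearing in S1**: with that binder deleted,
  `TransportStationary` is FALSE.  Witness `N = 2`, `L = 1`, `w =` the square well of height `1` and
  radius `2` (`ω₃ ≤ w^per ≤ 27ω₃` on the whole cell by the squeeze of `PeriodisedWell`, `ω₃ = |B₁| > 0`),
  `n = 0`, `s = 0`, `Φ =` the modulated product state (finite energy): at `n = 0` the kinetic stress wave
  and `|k|²` vanish (Lean junk `x/0 = 0` included), `N_eff = 0`, and the virial wave degenerates to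
  `2∫ W|Φ'|² ≥ 2ω₃ > 0` for EVERY state `Φ'`, so no state is "transport-stationary".  This certifies
  the stub docstring's "FALSE at `n = 0`" and Disproof (a) at the level of S1: any proof of S1 uses
  `n ≠ 0`.  (`transportStationary_of_anyMode`: S1 is the `n ≠ 0` restriction of the mutated statement.)
-/

namespace Summit.AtomisticToContinuum.BoseEinsteinCondensation.Theorems.DensityResponse.Negative.ForceBalanceStubs

open MeasureTheory
open scoped ENNReal
open Literature.MathematicalPhysics.QuantumManyBody.BoseGas
open Summit.AtomisticToContinuum.BoseEinsteinCondensation.Cruxes.DensityResponse.ForceBalanceConstitutive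
open Summit.AtomisticToContinuum.BoseEinsteinCondensation.Theorems.DensityResponse.Negative

noncomputable section

/-! ## §A The stationarity identity -/

/-- `|k|² ≥ 0` (local copy; also `ForceBalanceConstitutive.ksq_nonneg` of the line's S3 file). [folklore] -/
private theorem ksq_nonneg (L : ℝ) (n : Fin 3 → ℤ) : 0 ≤ ksq L n :=
  mul_nonneg (sq_nonneg _) (Finset.sum_nonneg fun _ _ => sq_nonneg _)

/-- The stationarity identity solved for the stress–virial wave: `K + I = s·N_eff − (|k|²/4)·m`. [folklore] -/
theorem kin_add_virial_eq_of_stationary {N : ℕ} {L : ℝ} {w : ℝ → ℝ≥0∞} {n : Fin 3 → ℤ} {s : ℝ}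
    {Φ : PeriodicTrialState N L} (hstat : stressWave w n Φ = s * effNumber n Φ) :
    kineticStressWave n Φ + virialWave w n Φ = s * effNumber n Φ - ksq L n / 4 * sourceMean n Φ := by
  unfold stressWave at hstat
  linarith

/-! ## §B S2: the sign binder is decoration; the linear-response form -/

/-- `CoreIneq` with the binder `0 ≤ m(Φ)` deleted (everything else verbatim). -/
def CoreIneqNoSign (w : ℝ → ℝ≥0∞) (a M ρ₀ κ C₁ : ℝ) (N₀ : ℕ) : Prop :=
  ∀ N : ℕ, N₀ ≤ N → ∀ L : ℝ, 0 < L → (N : ℝ) ≤ ρ₀ * L ^ 3 → ∀ n : Fin 3 → ℤ, n ≠ 0 →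
    2 * Real.pi * ‖(fun j => (n j : ℝ))‖ / L ≤ M * Real.sqrt (N / L ^ 3) →
    ∀ s : ℝ, 0 ≤ s → s ≤ N / L ^ 3 * a →
    ∀ Φ : PeriodicTrialState N L, periodicEnergy w Φ ≠ ⊤ →
      stressWave w n Φ = s * effNumber n Φ →
      (periodicEnergy w Φ).toReal - s * sourceMean n Φ ≤ (periodicGroundStateEnergy w N L).toReal →
        κ * (N / L ^ 3 * a) * sourceMean n Φ ≤ kineticStressWave n Φ + virialWave w n Φ + C₁ * s * N

/-- **The binder `0 ≤ m(Φ)` of S2 is not load-bearing** (for `a, κ, C₁ ≥ 0`, which the stub's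
`∃ κ C₁ > 0` and `a = (scatteringLength v).toReal ≥ 0` guarantee): on a transport-stationary state
with `m < 0` one has `K + I = s N_eff + (|k|²/4)|m| ≥ 0 ≥ κρa·m − C₁ s N`. [folklore] -/
theorem coreIneq_iff_noSign {w : ℝ → ℝ≥0∞} {a M ρ₀ κ C₁ : ℝ} {N₀ : ℕ}
    (ha : 0 ≤ a) (hκ : 0 ≤ κ) (hC₁ : 0 ≤ C₁) :
    CoreIneq w a M ρ₀ κ C₁ N₀ ↔ CoreIneqNoSign w a M ρ₀ κ C₁ N₀ := by
  constructor
  · intro h N hN L hL hNL n hn hwin s hs hsa Φ hE hstat hsub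
    rcases le_or_gt 0 (sourceMean n Φ) with hm | hm
    · exact h N hN L hL hNL n hn hwin s hs hsa Φ hE hstat hsub hm
    · have hNf : 0 ≤ effNumber n Φ := effNumber_nonneg n Φ
      have hq0 : 0 ≤ ksq L n := ksq_nonneg L n
      have hNnn : (0 : ℝ) ≤ N := Nat.cast_nonneg N
      have hρa : 0 ≤ κ * (N / L ^ 3 * a) := by positivity
      have h1 : κ * (N / L ^ 3 * a) * sourceMean n Φ ≤ 0 := mul_nonpos_of_nonneg_of_nonpos hρa hm.le
      have h2 : ksq L n / 4 * sourceMean n Φ ≤ 0 :=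
        mul_nonpos_of_nonneg_of_nonpos (div_nonneg hq0 (by norm_num)) hm.le
      have h3 : 0 ≤ C₁ * s * N := by positivity
      have h4 : 0 ≤ s * effNumber n Φ := mul_nonneg hs hNf
      rw [kin_add_virial_eq_of_stationary hstat]
      linarith
  · intro h N hN L hL hNL n hn hwin s hs hsa Φ hE hstat hsub _hm
    exact h N hN L hL hNL n hn hwin s hs hsa Φ hE hstat hsub

/-- S2 with the sign binder deleted. -/
def ConstitutiveCoreNoSign : Prop :=
  ∀ v : ℝ → ℝ≥0∞, IsRepulsiveFiniteRange v → ∀ M : ℝ, 0 < M →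
    ∃ ρ₀ κ C₁ : ℝ, 0 < ρ₀ ∧ 0 < κ ∧ 0 < C₁ ∧ ∃ N₀ t₀ : ℕ, ∀ t : ℕ, t₀ ≤ t →
      CoreIneqNoSign (truncPotential v t) (scatteringLength v).toReal M ρ₀ κ C₁ N₀

/-- **S2 ⟺ S2 without the sign binder.** [folklore] -/
theorem constitutiveCore_iff_noSign : ConstitutiveCore ↔ ConstitutiveCoreNoSign := by
  constructor
  · intro h v hv M hM
    obtain ⟨ρ₀, κ, C₁, hρ₀, hκ, hC₁, N₀, t₀, hcore⟩ := h v hv M hM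
    exact ⟨ρ₀, κ, C₁, hρ₀, hκ, hC₁, N₀, t₀, fun t ht =>
      (coreIneq_iff_noSign ENNReal.toReal_nonneg hκ.le hC₁.le).mp (hcore t ht)⟩
  · intro h v hv M hM
    obtain ⟨ρ₀, κ, C₁, hρ₀, hκ, hC₁, N₀, t₀, hcore⟩ := h v hv M hM
    exact ⟨ρ₀, κ, C₁, hρ₀, hκ, hC₁, N₀, t₀, fun t ht =>
      (coreIneq_iff_noSign ENNReal.toReal_nonneg hκ.le hC₁.le).mpr (hcore t ht)⟩

/-- The LINEAR-RESPONSE form of the constitutive inequality: same binders as `CoreIneq`, conclusion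
`(κρa + |k|²/4)·m ≤ s·N_eff + C₁·s·N`. -/
def CoreIneqLR (w : ℝ → ℝ≥0∞) (a M ρ₀ κ C₁ : ℝ) (N₀ : ℕ) : Prop :=
  ∀ N : ℕ, N₀ ≤ N → ∀ L : ℝ, 0 < L → (N : ℝ) ≤ ρ₀ * L ^ 3 → ∀ n : Fin 3 → ℤ, n ≠ 0 →
    2 * Real.pi * ‖(fun j => (n j : ℝ))‖ / L ≤ M * Real.sqrt (N / L ^ 3) →
    ∀ s : ℝ, 0 ≤ s → s ≤ N / L ^ 3 * a →
    ∀ Φ : PeriodicTrialState N L, periodicEnergy w Φ ≠ ⊤ →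
      stressWave w n Φ = s * effNumber n Φ →
      (periodicEnergy w Φ).toReal - s * sourceMean n Φ ≤ (periodicGroundStateEnergy w N L).toReal →
      0 ≤ sourceMean n Φ →
        (κ * (N / L ^ 3 * a) + ksq L n / 4) * sourceMean n Φ ≤ s * effNumber n Φ + C₁ * s * N

/-- **On transport-stationary states the constitutive inequality IS the linear-response bound**
`m ≤ s(N_eff + C₁N)/(κρa + |k|²/4)` — a rearrangement of `K + (|k|²/4)m + I = s N_eff`. [folklore] -/
theorem coreIneq_iff_lr {w : ℝ → ℝ≥0∞} {a M ρ₀ κ C₁ : ℝ} {N₀ : ℕ} :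
    CoreIneq w a M ρ₀ κ C₁ N₀ ↔ CoreIneqLR w a M ρ₀ κ C₁ N₀ := by
  constructor
  · intro h N hN L hL hNL n hn hwin s hs hsa Φ hE hstat hsub hm
    have key := h N hN L hL hNL n hn hwin s hs hsa Φ hE hstat hsub hm
    have e := kin_add_virial_eq_of_stationary hstat
    have r : (κ * (N / L ^ 3 * a) + ksq L n / 4) * sourceMean n Φ =
        κ * (N / L ^ 3 * a) * sourceMean n Φ + ksq L n / 4 * sourceMean n Φ := by ring
    linarith
  · intro h N hN L hL hNL n hn hwin s hs hsa Φ hE hstat hsub hm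
    have key := h N hN L hL hNL n hn hwin s hs hsa Φ hE hstat hsub hm
    have e := kin_add_virial_eq_of_stationary hstat
    have r : (κ * (N / L ^ 3 * a) + ksq L n / 4) * sourceMean n Φ =
        κ * (N / L ^ 3 * a) * sourceMean n Φ + ksq L n / 4 * sourceMean n Φ := by ring
    linarith

/-- **Necessary size of `C₁`**: on a transport-stationary state the constitutive inequality forces
`(κρa + |k|²/4)·m ≤ (2 + C₁)·s·N` (as `N_eff ≤ 2N` is not needed here we record the sharper
`≤ s·N_eff + C₁ s N`); conversely it is implied by `(κρa + |k|²/4)·m ≤ C₁·s·N`.  The content of S2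
is therefore exactly a bound `m(Φ) ≤ C s N/(ρa + |k|²)` on sub-ground transport-stationary states,
i.e. the crux's chord at drive `2s`. [folklore] -/
theorem coreIneq_of_lr_bound {w : ℝ → ℝ≥0∞} {a M ρ₀ κ C₁ : ℝ} {N₀ : ℕ}
    (h : ∀ N : ℕ, N₀ ≤ N → ∀ L : ℝ, 0 < L → (N : ℝ) ≤ ρ₀ * L ^ 3 → ∀ n : Fin 3 → ℤ, n ≠ 0 →
      2 * Real.pi * ‖(fun j => (n j : ℝ))‖ / L ≤ M * Real.sqrt (N / L ^ 3) →
      ∀ s : ℝ, 0 ≤ s → s ≤ N / L ^ 3 * a →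
      ∀ Φ : PeriodicTrialState N L, periodicEnergy w Φ ≠ ⊤ →
        stressWave w n Φ = s * effNumber n Φ →
        (periodicEnergy w Φ).toReal - s * sourceMean n Φ ≤ (periodicGroundStateEnergy w N L).toReal →
        0 ≤ sourceMean n Φ →
          (κ * (N / L ^ 3 * a) + ksq L n / 4) * sourceMean n Φ ≤ C₁ * s * N) :
    CoreIneq w a M ρ₀ κ C₁ N₀ := by
  refine coreIneq_iff_lr.mpr fun N hN L hL hNL n hn hwin s hs hsa Φ hE hstat hsub hm => ?_
  have key := h N hN L hL hNL n hn hwin s hs hsa Φ hE hstat hsub hm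
  have h4 : 0 ≤ s * effNumber n Φ := mul_nonneg hs (effNumber_nonneg n Φ)
  linarith

/-! ## §C S1: the mode binder `n ≠ 0` is load-bearing -/

/-- S1 with the binder `n ≠ 0` deleted (everything else verbatim). -/
def TransportStationaryAnyMode : Prop :=
  ∀ (N : ℕ) (L : ℝ) (w : ℝ → ℝ≥0∞), IsRepulsiveFiniteRange w → (∃ B : ℝ, ∀ r, w r ≤ ENNReal.ofReal B) →
    0 < L → ∀ n : Fin 3 → ℤ, ∀ s : ℝ, 0 ≤ s → ∀ Φ : PeriodicTrialState N L,
      periodicEnergy w Φ ≠ ⊤ →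
      ∃ Φ' : PeriodicTrialState N L, periodicEnergy w Φ' ≠ ⊤ ∧
        (periodicEnergy w Φ').toReal - s * sourceMean n Φ' ≤
            (periodicEnergy w Φ).toReal - s * |sourceMean n Φ| ∧
        stressWave w n Φ' = s * effNumber n Φ'

/-- S1 is the `n ≠ 0` restriction of the mutated statement. [folklore] -/
theorem transportStationary_of_anyMode (h : TransportStationaryAnyMode) : TransportStationary :=
  fun N L w hw hb hL n _ s hs Φ hΦ => h N L w hw hb hL n s hs Φ hΦ

section ZeroMode

variable {N : ℕ} {L : ℝ}

/-- At `n = 0`: `|k|² = 0`. [folklore] -/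
theorem ksq_zero_mode (L : ℝ) : ksq L 0 = 0 := by
  simp [ksq]

/-- At `n = 0` every phase vanishes. [folklore] -/
theorem phase_zero_mode (L : ℝ) (X : Config N) (i : Fin N) : phase L 0 X i = 0 := by
  simp [phase]

/-- At `n = 0` the kinetic stress wave vanishes (its weight `1/|k|²` is Lean-junk `1/0 = 0`). [folklore] -/
theorem kineticStressWave_zero_mode (Φ : PeriodicTrialState N L) : kineticStressWave 0 Φ = 0 := by
  unfold kineticStressWave
  simp [ksq_zero_mode]

/-- At `n = 0`: `N_eff = 0`. [folklore] -/
theorem effNumber_zero_mode (Φ : PeriodicTrialState N L) : effNumber 0 Φ = 0 := by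
  unfold effNumber
  simp [phase_zero_mode]

/-- At `n = 0` the virial wave degenerates to `N ∫ W |Φ|²` (here written with the sum over particles). [folklore] -/
theorem virialWave_zero_mode (w : ℝ → ℝ≥0∞) (Φ : PeriodicTrialState N L) :
    virialWave w 0 Φ = ∫ X in cellN N L, (periodicInteraction w L X).toReal * (N * ‖Φ.ψ X‖ ^ 2) := by
  unfold virialWave
  congr 1
  funext X
  simp [phase_zero_mode]

/-- At `n = 0` the stress wave is the degenerate virial wave. [folklore] -/
theorem stressWave_zero_mode (w : ℝ → ℝ≥0∞) (Φ : PeriodicTrialState N L) :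
    stressWave w 0 Φ = ∫ X in cellN N L, (periodicInteraction w L X).toReal * (N * ‖Φ.ψ X‖ ^ 2) := by
  unfold stressWave
  rw [kineticStressWave_zero_mode, ksq_zero_mode, virialWave_zero_mode]
  ring

end ZeroMode

/-- `ω₃ = |B₁| > 0`. [folklore] -/
theorem ω₃_pos : 0 < ω₃ :=
  ENNReal.toReal_pos (Metric.measure_closedBall_pos volume _ one_pos).ne' measure_closedBall_lt_top.ne

/-- `#pairs(2) = 1`. [folklore] -/
theorem pairCount_two : pairCount 2 = 1 := by
  unfold pairCount
  decide

/-- The witness potential: the square well of height `1` and radius `2`. -/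
abbrev wsq : ℝ → ℝ≥0∞ := sqWell 1 2

/-- The witness potential is bounded by `1`. [folklore] -/
theorem wsq_le_one (r : ℝ) : wsq r ≤ ENNReal.ofReal 1 := by
  unfold wsq sqWell
  by_cases hr : r ∈ Set.Iic (2 : ℝ)
  · rw [Set.indicator_of_mem hr]
  · rw [Set.indicator_of_notMem hr]; exact bot_le

/-- On the torus of side `1`, `ω₃ ≤ w^per ≤ 27 ω₃` everywhere. [folklore] -/
theorem wsq_periodized_bounds (y : Space) :
    ENNReal.ofReal ω₃ ≤ periodizedPotential wsq 1 y ∧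
      periodizedPotential wsq 1 y ≤ ENNReal.ofReal (27 * ω₃) := by
  constructor
  · have h := le_periodizedPotential_sqWell (K := 1) (R := 2) (L := 1) zero_le_one one_pos
      (by norm_num) y
    refine le_trans (le_of_eq ?_) h
    congr 1; norm_num
  · have h := periodizedPotential_sqWell_le (K := 1) (R := 2) (L := 1) zero_le_one (by norm_num)
      one_pos y
    refine h.trans (le_of_eq ?_)
    congr 1; norm_num

/-- Two particles: `ω₃ ≤ W ≤ 27 ω₃` on every configuration. [folklore] -/
theorem wsq_interaction_bounds (X : Config 2) :
    ENNReal.ofReal ω₃ ≤ periodicInteraction wsq 1 X ∧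
      periodicInteraction wsq 1 X ≤ ENNReal.ofReal (27 * ω₃) := by
  constructor
  · have h := le_periodicInteraction_of_le (N := 2) (fun y => (wsq_periodized_bounds y).1) X
    rwa [pairCount_two, Nat.cast_one, one_mul] at h
  · have h := periodicInteraction_le_of_le (N := 2) (fun y => (wsq_periodized_bounds y).2) X
    rwa [pairCount_two, Nat.cast_one, one_mul] at h

/-- **`n ≠ 0` is load-bearing in S1.** [folklore] -/
theorem not_transportStationaryAnyMode : ¬ TransportStationaryAnyMode := by
  intro h
  have hL : (0 : ℝ) < 1 := one_pos
  -- the data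
  have hw : IsRepulsiveFiniteRange wsq := isRepulsiveFiniteRange_sqWell 1 2
  have hb : ∃ B : ℝ, ∀ r, wsq r ≤ ENNReal.ofReal B := ⟨1, wsq_le_one⟩
  -- the modulated product state has finite energy
  set Φ : PeriodicTrialState 2 1 := prodState 2 hL with hΦdef
  have hΦE : periodicEnergy wsq Φ ≠ ⊤ := by
    have hle := periodicEnergy_le_of_pointwise Φ (v := wsq)
      (t := ENNReal.ofReal (3 * (2 : ℕ) * (2 * Real.pi / 1) ^ 2)) (b := ENNReal.ofReal (27 * ω₃))
      ENNReal.ofReal_ne_top ENNReal.ofReal_ne_top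
      (fun X => by rw [hΦdef]; exact kineticDensity_prodState_le 2 hL X)
      (fun y => (wsq_periodized_bounds y).2)
    exact ne_top_of_le_ne_top (by
      refine ENNReal.add_ne_top.mpr ⟨ENNReal.ofReal_ne_top, ENNReal.mul_ne_top (by simp) ENNReal.ofReal_ne_top⟩)
      hle
  obtain ⟨Φ', -, -, hstat⟩ := h 2 1 wsq hw hb hL 0 0 le_rfl Φ hΦE
  -- at `n = 0`, `s = 0` stationarity says `∫ W · 2|Φ'|² = 0`
  rw [stressWave_zero_mode, zero_mul] at hstat
  -- but the integrand is `≥ 2 ω₃ |Φ'|²`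
  have hψc : Continuous fun X : Config 2 => ‖Φ'.ψ X‖ ^ 2 := (Φ'.contDiff.continuous.norm).pow 2
  have hWm : Measurable fun X : Config 2 => (periodicInteraction wsq 1 X).toReal :=
    (measurable_periodicInteraction hw.1 1).ennreal_toReal
  have hlow : ∀ X : Config 2, ω₃ ≤ (periodicInteraction wsq 1 X).toReal := fun X =>
    (ENNReal.ofReal_le_iff_le_toReal
      (ne_top_of_le_ne_top ENNReal.ofReal_ne_top (wsq_interaction_bounds X).2)).mp
      (wsq_interaction_bounds X).1
  have hup : ∀ X : Config 2, (periodicInteraction wsq 1 X).toReal ≤ 27 * ω₃ := fun X =>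
    ENNReal.toReal_le_of_le_ofReal (by positivity [ω₃_nonneg]) (wsq_interaction_bounds X).2
  have hgi : Integrable (fun X : Config 2 => ω₃ * ((2 : ℕ) * ‖Φ'.ψ X‖ ^ 2))
      (volume.restrict (cellN 2 1)) :=
    integrableOn_cellN (continuous_const.mul (continuous_const.mul hψc)) 1
  have hGi : Integrable (fun X : Config 2 => 27 * ω₃ * ((2 : ℕ) * ‖Φ'.ψ X‖ ^ 2))
      (volume.restrict (cellN 2 1)) :=
    integrableOn_cellN (continuous_const.mul (continuous_const.mul hψc)) 1
  have hfi : Integrable (fun X : Config 2 =>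
      (periodicInteraction wsq 1 X).toReal * ((2 : ℕ) * ‖Φ'.ψ X‖ ^ 2)) (volume.restrict (cellN 2 1)) := by
    refine hGi.mono' (hWm.aestronglyMeasurable.mul
      (continuous_const.mul hψc).aestronglyMeasurable) (Filter.Eventually.of_forall fun X => ?_)
    rw [Real.norm_eq_abs, abs_of_nonneg (mul_nonneg ENNReal.toReal_nonneg (by positivity))]
    exact mul_le_mul_of_nonneg_right (hup X) (by positivity)
  have hmono : ∫ X in cellN 2 1, ω₃ * ((2 : ℕ) * ‖Φ'.ψ X‖ ^ 2) ≤
      ∫ X in cellN 2 1, (periodicInteraction wsq 1 X).toReal * ((2 : ℕ) * ‖Φ'.ψ X‖ ^ 2) :=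
    integral_mono hgi hfi fun X => mul_le_mul_of_nonneg_right (hlow X) (by positivity)
  have hval : ∫ X in cellN 2 1, ω₃ * ((2 : ℕ) * ‖Φ'.ψ X‖ ^ 2) = 2 * ω₃ := by
    rw [integral_const_mul, integral_const_mul, integral_norm_sq_eq_one]
    push_cast
    ring
  rw [hstat] at hmono
  rw [hval] at hmono
  linarith [ω₃_pos]

end

end Summit.AtomisticToContinuum.BoseEinsteinCondensation.Theorems.DensityResponse.Negative.ForceBalanceStubs
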